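/-
Copyright: harness tree, Literature layer (sorry-free). b2b-lace enum1-g54 (ENUMERATION SHARD A gen 54),
node KU-SEP-KERNEL-STAGED: the STAGED evaluation of the product-row twisted SEEDCERT kernel checks
(computable layer + the replay lemmas; number-free, `d`-generic).
-/
import Literature.Probability.FitznerVanDerHofstad2017.SrwTwistProdCertKernel
import HarnessLib

/-!
# Product-row twisted SEEDCERT kernel: staged evaluation

`PrCert.checkP` (module `SrwTwistProdCertKernel`) is proved in an instance file from five separately
kernel-decided conjuncts.  Two of them make the kernel evaluate a whole CHAIN of Gaussian list products
inside ONE declaration — `tailCheckIM` (the product `∏_r P_{a_r}(w)^{p_r}` of the class polynomials,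
`PrCert.powRe2`) and `poissonCheckP` (the product table `∏_r (Θ_1^{(a_r)})^{p_r}`, `PrCert.tableP`) —
and `paramsOKP` evaluates the exact main-term coefficient lists `midList b J_b` of every Bessel order
`b ≤ Jm + max a`.  The kernel keeps every intermediate value of one declaration alive, so the memory of
such a declaration grows with the whole chain, and past a size the check cannot be replayed.

This module STAGES those evaluations without changing what is certified:
* `PrCertS` extends `PrCert` by three CLAIMED tables — `mids` (the `2^S`-scaled main coefficient lists
  `Mid_b`, `b ≤ Jm + max a`), `resW` (the successive products of the `w`-polynomial chain) and `resP`
  (the successive products of the table chain);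
* the chains are re-run by REPLAY (`mulT`): every product is looked up from the claimed list instead of
  being computed, and the operands it was asked for are recorded in a TRACE (`PrCertS.traceW`,
  `PrCertS.traceP`); the class polynomials are assembled from `mids` (`gzP2S`);
* the obligations are LOCAL and each is its own `decide`: `ordOK b` (order `b`: bracket constant, dyadic
  main coefficients, and `mids[b] = Mid_b`; chunked as `ordOKR lo n`), `stepWOK k` / `stepPOK k` (the
  `k`-th recorded product IS the product of its recorded operands — one multiplication each);
* `paramsOKP_of_staged`, `poissonCheckP_of_staged`, `tailCheckIM_of_staged`: the original conjuncts of
  `PrCert.checkP` follow from the staged Booleans and the local obligations (pure rewriting: a replay all of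
  whose trace entries are good returns the value of the original chain, `gzWProdM_trace`, `gzProdM_trace`).
So an instance proves the SAME five conjuncts of `PrCert.checkP` and every consumer
(`PrCert.checkP_intro`, `PrCert.soundP_of_parts`, `PrCert.srwTwistProdCosPow_mem_of_parts`, …) is unchanged.
The generators `PrCert.midsGen`, `PrCert.resWGen`, `PrCert.resPGen` compute the three tables (interpreter side,
e.g. `eval%` in an instance file); nothing is assumed about them — the local obligations check the tables.
[cite: FitznerVanDerHofstad2016NoBLE, §5.1.1 (5.2)–(5.5) pp. 1089–1090]
-/

set_option Elab.async false

namespace Literature.Probability.FitznerVanDerHofstad2017.SeedCert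

open Finset

/-! ### Replay of a product chain through a list of claimed results -/

/-- A trace entry of a replayed product: the claimed result `C`, the operation parameter `k`, the operands
`A`, `B`. [folklore] -/
abbrev MulEntry (κ : Type) := GZ × κ × GZ × GZ

/-- The replay state: the claimed results not yet consumed and the trace so far. [folklore] -/
abbrev MulState (κ : Type) := List GZ × List (MulEntry κ)

/-- REPLAY of one product `op k A B`: consume the next claimed result `C` (if none is left: compute the
product) and append `(C, k, A, B)` to the trace. [folklore] -/
def mulT {κ : Type} (op : κ → GZ → GZ → GZ) (k : κ) (A B : GZ) (s : MulState κ) : GZ × MulState κ :=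
  match s.1 with
  | C :: rs => (C, (rs, s.2 ++ [(C, k, A, B)]))
  | [] => (op k A B, ([], s.2 ++ [(op k A B, k, A, B)]))

/-- RECORDING of one product (generator side: computes the product and appends it to the result list).
[folklore] -/
def mulRec {κ : Type} (op : κ → GZ → GZ → GZ) (k : κ) (A B : GZ) (s : List GZ) : GZ × List GZ :=
  let C := op k A B
  (C, s ++ [C])

/-- The plain product as a state-threading operation (state untouched). [folklore] -/
def mulId {κ σ : Type} (op : κ → GZ → GZ → GZ) (k : κ) (A B : GZ) (s : σ) : GZ × σ := (op k A B, s)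

/-- A trace entry is GOOD when its claimed result is the product of its operands. [cite: FitznerVanDerHofstad2016NoBLE, §5.1.1 (5.4)–(5.5) pp. 1089–1090] -/
def GoodEntry {κ : Type} (op : κ → GZ → GZ → GZ) (e : MulEntry κ) : Prop :=
  e.1 = op e.2.1 e.2.2.1 e.2.2.2

/-- Replay appends to the trace, and returns the true product when the appended entries are good. [folklore] -/
private theorem mulT_trace {κ : Type} (op : κ → GZ → GZ → GZ) (k : κ) (A B : GZ) (s : MulState κ) :
    ∃ new : List (MulEntry κ), (mulT op k A B s).2.2 = s.2 ++ new ∧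
      ((∀ e ∈ new, GoodEntry op e) → (mulT op k A B s).1 = op k A B) := by
  rcases s with ⟨rs, tr⟩
  cases rs with
  | nil => exact ⟨[(op k A B, k, A, B)], rfl, fun _ => rfl⟩
  | cons C rs => exact ⟨[(C, k, A, B)], rfl, fun h => h (C, k, A, B) (List.mem_singleton.2 rfl)⟩

/-- The `k`-th trace entry is good (Boolean; `true` past the end of the trace). [folklore] -/
def stepOK {κ : Type} (op : κ → GZ → GZ → GZ) (tr : List (MulEntry κ)) (k : ℕ) : Bool :=
  match tr[k]? with
  | none => true
  | some e => op e.2.1 e.2.2.1 e.2.2.2 == e.1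

/-- The trace entries `lo ≤ k < lo + n` are good. [folklore] -/
def stepOKR {κ : Type} (op : κ → GZ → GZ → GZ) (tr : List (MulEntry κ)) (lo n : ℕ) : Bool :=
  (List.range' lo n).all (stepOK op tr)

/-- `stepOKR` unfolded: every index of the range is a good step. [folklore] -/
private theorem stepOKR_iff {κ : Type} (op : κ → GZ → GZ → GZ) (tr : List (MulEntry κ)) (lo n : ℕ) :
    stepOKR op tr lo n = true ↔ ∀ k, lo ≤ k → k < lo + n → stepOK op tr k = true := by
  unfold stepOKR
  rw [List.all_eq_true]
  constructor
  · intro h k h1 h2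
    exact h k (List.mem_range'_1.2 ⟨h1, h2⟩)
  · intro h k hk
    obtain ⟨h1, h2⟩ := List.mem_range'_1.1 hk
    exact h k h1 h2

/-- Gluing of two adjacent ranges of good entries. [folklore] -/
private theorem stepOKR_append {κ : Type} (op : κ → GZ → GZ → GZ) (tr : List (MulEntry κ)) (lo n₁ lo₂ n₂ n : ℕ)
    (hlo : lo₂ = lo + n₁) (hn : n = n₁ + n₂) (h₁ : stepOKR op tr lo n₁ = true)
    (h₂ : stepOKR op tr lo₂ n₂ = true) : stepOKR op tr lo n = true := by
  subst hlo hn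
  rw [stepOKR_iff] at h₁ h₂ ⊢
  intro k hk1 hk2
  by_cases hk : k < lo + n₁
  · exact h₁ k hk1 hk
  · exact h₂ k (by omega) (by omega)

/-- All trace entries good from the Boolean over the whole index range. [folklore] -/
private theorem good_of_stepOKR {κ : Type} (op : κ → GZ → GZ → GZ) (tr : List (MulEntry κ))
    (h : stepOKR op tr 0 tr.length = true) : ∀ e ∈ tr, GoodEntry op e := by
  intro e he
  obtain ⟨k, hk, hke⟩ := List.getElem_of_mem he
  have hs := (stepOKR_iff op tr 0 tr.length).1 h k (Nat.zero_le _) (by simpa using hk)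
  unfold stepOK at hs
  rw [List.getElem?_eq_getElem hk, hke] at hs
  simp only [beq_iff_eq] at hs
  exact hs.symm

/-! ### The `w`-polynomial chain, generic in the product -/

/-- `gzPowWAux` with the product replaced by a state-threading `mul`. [cite: FitznerVanDerHofstad2016NoBLE, §5.1.1 (5.4)–(5.5) pp. 1089–1090] -/
def gzPowWAuxM {σ : Type} (mul : ℕ → GZ → GZ → σ → GZ × σ) (ℓ : ℕ) (X : GZ) : ℕ → ℕ → σ → GZ × σ
  | 0, _, s => (X, s)
  | fuel + 1, p, s =>
      bif Nat.ble p 1 then (X, s)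
      else bif p % 2 == 0 then
        let r := gzPowWAuxM mul ℓ X fuel (p / 2) s
        mul (p * (ℓ - 1) + 1) r.1 r.1 r.2
      else
        let r := gzPowWAuxM mul ℓ X fuel (p - 1) s
        mul (p * (ℓ - 1) + 1) X r.1 r.2

/-- `gzWProdAux` with the product replaced by `mul` and the class polynomial by `P`. [cite: FitznerVanDerHofstad2016NoBLE, §5.1.1 (5.4)–(5.5) pp. 1089–1090] -/
def gzWProdAuxM {σ : Type} (mul : ℕ → GZ → GZ → σ → GZ × σ) (P : ℕ → GZ) (ℓ : ℕ) :
    GZ → ℕ → List (ℕ × ℕ) → σ → (GZ × ℕ) × σ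
  | acc, len, [], s => ((acc, len), s)
  | acc, len, (a, p) :: t, s =>
      let r := gzPowWAuxM mul ℓ (P a) p p s
      let r2 := mul (len + p * (ℓ - 1)) acc r.1 r.2
      gzWProdAuxM mul P ℓ r2.1 (len + p * (ℓ - 1)) t r2.2

/-- `gzWProd` with the product replaced by `mul` and the class polynomial by `P`. [cite: FitznerVanDerHofstad2016NoBLE, §5.1.1 (5.4)–(5.5) pp. 1089–1090] -/
def gzWProdM {σ : Type} (mul : ℕ → GZ → GZ → σ → GZ × σ) (P : ℕ → GZ) (ℓ : ℕ) :
    List (ℕ × ℕ) → σ → (GZ × ℕ) × σ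
  | [], s => (((zeroPN 1, zeroPN 1), 1), s)
  | (a, p) :: t, s =>
      let r := gzPowWAuxM mul ℓ (P a) p p s
      gzWProdAuxM mul P ℓ r.1 (p * (ℓ - 1) + 1) t r.2

/-- With the computing product `mulId` the generic power recursion is the original one. [folklore] -/
private theorem gzPowWAuxM_id {σ : Type} (ℓ : ℕ) (X : GZ) :
    ∀ (fuel p : ℕ) (s : σ), gzPowWAuxM (mulId (fun L A B => gzMulW L A B)) ℓ X fuel p s = (gzPowWAux ℓ X fuel p, s) := by
  intro fuel
  induction fuel with
  | zero => intro p s; rfl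
  | succ fuel ih =>
      intro p s
      simp only [gzPowWAuxM, gzPowWAux, ih, mulId]
      cases Nat.ble p 1 <;> cases (p % 2 == 0) <;> rfl

/-- With the computing product `mulId` the generic fold is the original one. [folklore] -/
private theorem gzWProdAuxM_id {σ : Type} (Jb S ℓ m J : ℕ) (Q : ℕ → ℤ) :
    ∀ (t : List (ℕ × ℕ)) (acc : GZ) (len : ℕ) (s : σ),
      gzWProdAuxM (mulId (fun L A B => gzMulW L A B)) (fun a => gzP2 Jb S ℓ m a J Q) ℓ acc len t s
        = (gzWProdAux Jb S ℓ m J Q acc len t, s) := by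
  intro t
  induction t with
  | nil => intro acc len s; rfl
  | cons ap t ih =>
      intro acc len s
      obtain ⟨a, p⟩ := ap
      simp only [gzWProdAuxM, gzWProdAux, gzPowWAuxM_id, gzPowW, mulId, ih]

/-- With the computing product `mulId` the generic chain is the original chain `gzWProd`. [folklore] -/
private theorem gzWProdM_id {σ : Type} (Jb S ℓ m J : ℕ) (Q : ℕ → ℤ) (cls : List (ℕ × ℕ)) (s : σ) :
    gzWProdM (mulId (fun L A B => gzMulW L A B)) (fun a => gzP2 Jb S ℓ m a J Q) ℓ cls s
      = (gzWProd Jb S ℓ m J Q cls, s) := by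
  cases cls with
  | nil => rfl
  | cons ap t =>
      obtain ⟨a, p⟩ := ap
      simp only [gzWProdM, gzWProd, gzPowWAuxM_id, gzPowW, gzWProdAuxM_id]

/-- Replay of the power recursion: the trace grows, and if the new entries are good the value is the true power. [folklore] -/
private theorem gzPowWAuxM_trace (ℓ : ℕ) (X : GZ) :
    ∀ (fuel p : ℕ) (s : MulState ℕ), ∃ new : List (MulEntry ℕ),
      (gzPowWAuxM (mulT (fun L A B => gzMulW L A B)) ℓ X fuel p s).2.2 = s.2 ++ new ∧
      ((∀ e ∈ new, GoodEntry (fun L A B => gzMulW L A B) e) →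
        (gzPowWAuxM (mulT (fun L A B => gzMulW L A B)) ℓ X fuel p s).1 = gzPowWAux ℓ X fuel p) := by
  intro fuel
  induction fuel with
  | zero => intro p s; exact ⟨[], by simp [gzPowWAuxM], fun _ => rfl⟩
  | succ fuel ih =>
      intro p s
      simp only [gzPowWAuxM, gzPowWAux]
      cases Nat.ble p 1 with
      | true => exact ⟨[], by simp, fun _ => rfl⟩
      | false =>
        cases (p % 2 == 0) with
        | true =>
          simp only [cond_true, cond_false]
          obtain ⟨new₁, h₁, g₁⟩ := ih (p / 2) s
          obtain ⟨new₂, h₂, g₂⟩ := mulT_trace (fun L A B => gzMulW L A B) (p * (ℓ - 1) + 1)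
            (gzPowWAuxM (mulT fun L A B => gzMulW L A B) ℓ X fuel (p / 2) s).1
            (gzPowWAuxM (mulT fun L A B => gzMulW L A B) ℓ X fuel (p / 2) s).1
            (gzPowWAuxM (mulT fun L A B => gzMulW L A B) ℓ X fuel (p / 2) s).2
          refine ⟨new₁ ++ new₂, by rw [h₂, h₁, List.append_assoc], fun hall => ?_⟩
          have ga : ∀ e ∈ new₁, GoodEntry (fun L A B => gzMulW L A B) e :=
            fun e he => hall e (List.mem_append_left _ he)
          have gb : ∀ e ∈ new₂, GoodEntry (fun L A B => gzMulW L A B) e :=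
            fun e he => hall e (List.mem_append_right _ he)
          rw [g₂ gb, g₁ ga]
        | false =>
          simp only [cond_false]
          obtain ⟨new₁, h₁, g₁⟩ := ih (p - 1) s
          obtain ⟨new₂, h₂, g₂⟩ := mulT_trace (fun L A B => gzMulW L A B) (p * (ℓ - 1) + 1) X
            (gzPowWAuxM (mulT fun L A B => gzMulW L A B) ℓ X fuel (p - 1) s).1
            (gzPowWAuxM (mulT fun L A B => gzMulW L A B) ℓ X fuel (p - 1) s).2
          refine ⟨new₁ ++ new₂, by rw [h₂, h₁, List.append_assoc], fun hall => ?_⟩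
          have ga : ∀ e ∈ new₁, GoodEntry (fun L A B => gzMulW L A B) e :=
            fun e he => hall e (List.mem_append_left _ he)
          have gb : ∀ e ∈ new₂, GoodEntry (fun L A B => gzMulW L A B) e :=
            fun e he => hall e (List.mem_append_right _ he)
          rw [g₂ gb, g₁ ga]

/-- Replay of the fold: the trace grows, and if the new entries are good the value is the true fold. [folklore] -/
private theorem gzWProdAuxM_trace (P : ℕ → GZ) (ℓ : ℕ) :
    ∀ (t : List (ℕ × ℕ)) (acc : GZ) (len : ℕ) (s : MulState ℕ), ∃ new : List (MulEntry ℕ),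
      (gzWProdAuxM (mulT (fun L A B => gzMulW L A B)) P ℓ acc len t s).2.2 = s.2 ++ new ∧
      ((∀ e ∈ new, GoodEntry (fun L A B => gzMulW L A B) e) →
        (gzWProdAuxM (mulT (fun L A B => gzMulW L A B)) P ℓ acc len t s).1
          = (gzWProdAuxM (mulId (fun L A B => gzMulW L A B)) P ℓ acc len t ()).1) := by
  intro t
  induction t with
  | nil => intro acc len s; exact ⟨[], by simp [gzWProdAuxM], fun _ => rfl⟩
  | cons ap t ih =>
      intro acc len s
      obtain ⟨a, p⟩ := ap
      simp only [gzWProdAuxM]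
      obtain ⟨new₁, h₁, g₁⟩ := gzPowWAuxM_trace ℓ (P a) p p s
      obtain ⟨new₂, h₂, g₂⟩ := mulT_trace (fun L A B => gzMulW L A B) (len + p * (ℓ - 1)) acc
        (gzPowWAuxM (mulT fun L A B => gzMulW L A B) ℓ (P a) p p s).1
        (gzPowWAuxM (mulT fun L A B => gzMulW L A B) ℓ (P a) p p s).2
      obtain ⟨new₃, h₃, g₃⟩ := ih
        (mulT (fun L A B => gzMulW L A B) (len + p * (ℓ - 1)) acc
          (gzPowWAuxM (mulT fun L A B => gzMulW L A B) ℓ (P a) p p s).1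
          (gzPowWAuxM (mulT fun L A B => gzMulW L A B) ℓ (P a) p p s).2).1
        (len + p * (ℓ - 1))
        (mulT (fun L A B => gzMulW L A B) (len + p * (ℓ - 1)) acc
          (gzPowWAuxM (mulT fun L A B => gzMulW L A B) ℓ (P a) p p s).1
          (gzPowWAuxM (mulT fun L A B => gzMulW L A B) ℓ (P a) p p s).2).2
      refine ⟨new₁ ++ new₂ ++ new₃, by rw [h₃, h₂, h₁]; simp only [List.append_assoc], fun hall => ?_⟩
      have ga : ∀ e ∈ new₁, GoodEntry (fun L A B => gzMulW L A B) e :=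
        fun e he => hall e (by simp [he])
      have gb : ∀ e ∈ new₂, GoodEntry (fun L A B => gzMulW L A B) e :=
        fun e he => hall e (by simp [he])
      have gc : ∀ e ∈ new₃, GoodEntry (fun L A B => gzMulW L A B) e :=
        fun e he => hall e (by simp [he])
      rw [g₃ gc, g₂ gb, g₁ ga]
      simp only [mulId, gzPowWAuxM_id]

/-- Replay of the chain: the trace grows, and if the new entries are good the value is the true product. [folklore] -/
private theorem gzWProdM_trace (P : ℕ → GZ) (ℓ : ℕ) (cls : List (ℕ × ℕ)) (s : MulState ℕ) :
    ∃ new : List (MulEntry ℕ),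
      (gzWProdM (mulT (fun L A B => gzMulW L A B)) P ℓ cls s).2.2 = s.2 ++ new ∧
      ((∀ e ∈ new, GoodEntry (fun L A B => gzMulW L A B) e) →
        (gzWProdM (mulT (fun L A B => gzMulW L A B)) P ℓ cls s).1
          = (gzWProdM (mulId (fun L A B => gzMulW L A B)) P ℓ cls ()).1) := by
  cases cls with
  | nil => exact ⟨[], by simp [gzWProdM], fun _ => rfl⟩
  | cons ap t =>
      obtain ⟨a, p⟩ := ap
      simp only [gzWProdM]
      obtain ⟨new₁, h₁, g₁⟩ := gzPowWAuxM_trace ℓ (P a) p p s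
      obtain ⟨new₂, h₂, g₂⟩ := gzWProdAuxM_trace P ℓ t
        (gzPowWAuxM (mulT fun L A B => gzMulW L A B) ℓ (P a) p p s).1 (p * (ℓ - 1) + 1)
        (gzPowWAuxM (mulT fun L A B => gzMulW L A B) ℓ (P a) p p s).2
      refine ⟨new₁ ++ new₂, by rw [h₂, h₁, List.append_assoc], fun hall => ?_⟩
      have ga : ∀ e ∈ new₁, GoodEntry (fun L A B => gzMulW L A B) e :=
        fun e he => hall e (List.mem_append_left _ he)
      have gb : ∀ e ∈ new₂, GoodEntry (fun L A B => gzMulW L A B) e :=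
        fun e he => hall e (List.mem_append_right _ he)
      rw [g₂ gb, g₁ ga]
      simp only [gzPowWAuxM_id]

/-- The class polynomial depends on `P` only through the classes present. [cite: FitznerVanDerHofstad2016NoBLE, §5.1.1 (5.4)–(5.5) pp. 1089–1090] -/
theorem gzWProdAuxM_congr {σ : Type} (mul : ℕ → GZ → GZ → σ → GZ × σ) (P P' : ℕ → GZ) (ℓ : ℕ) :
    ∀ (t : List (ℕ × ℕ)) (acc : GZ) (len : ℕ) (s : σ), (∀ ap ∈ t, P ap.1 = P' ap.1) →
      gzWProdAuxM mul P ℓ acc len t s = gzWProdAuxM mul P' ℓ acc len t s := by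
  intro t
  induction t with
  | nil => intro acc len s _; rfl
  | cons ap t ih =>
      intro acc len s h
      obtain ⟨a, p⟩ := ap
      simp only [gzWProdAuxM]
      rw [h (a, p) (by simp), ih _ _ _ (fun ap hap => h ap (by simp [hap]))]

/-- The generic chain depends on the class polynomials only through their values on the classes. [folklore] -/
private theorem gzWProdM_congr {σ : Type} (mul : ℕ → GZ → GZ → σ → GZ × σ) (P P' : ℕ → GZ) (ℓ : ℕ)
    (cls : List (ℕ × ℕ)) (s : σ) (h : ∀ ap ∈ cls, P ap.1 = P' ap.1) :
    gzWProdM mul P ℓ cls s = gzWProdM mul P' ℓ cls s := by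
  cases cls with
  | nil => rfl
  | cons ap t =>
      obtain ⟨a, p⟩ := ap
      simp only [gzWProdM]
      rw [h (a, p) (by simp), gzWProdAuxM_congr mul P P' ℓ t _ _ _ (fun ap hap => h ap (by simp [hap]))]

/-! ### The product table chain, generic in the product -/

/-- `gzPow2Aux` with the product replaced by a state-threading `mul` (parameter: the four parities).
[cite: FitznerVanDerHofstad2016NoBLE, §5.1.1 (5.4)–(5.5) pp. 1089–1090] -/
def gzPow2AuxM {σ : Type} (mul : (ℕ × ℕ × ℕ × ℕ) → GZ → GZ → σ → GZ × σ) (ρ σ' : ℕ) (R : GZ) :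
    ℕ → ℕ → σ → GZ × σ
  | 0, _, s => (R, s)
  | fuel + 1, p, s =>
      bif Nat.ble p 1 then (R, s)
      else bif p % 2 == 0 then
        let r := gzPow2AuxM mul ρ σ' R fuel (p / 2) s
        mul (rhoP ρ (p / 2), sigP ρ σ' (p / 2), rhoP ρ (p / 2), sigP ρ σ' (p / 2)) r.1 r.1 r.2
      else
        let r := gzPow2AuxM mul ρ σ' R fuel (p - 1) s
        mul (ρ, σ', rhoP ρ (p - 1), sigP ρ σ' (p - 1)) R r.1 r.2

/-- `gzProdAux` with the product replaced by `mul` and the class row by `row`. [cite: FitznerVanDerHofstad2016NoBLE, §5.1.1 (5.4)–(5.5) pp. 1089–1090] -/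
def gzProdAuxM {σ : Type} (mul : (ℕ × ℕ × ℕ × ℕ) → GZ → GZ → σ → GZ × σ) (row : ℕ → GZ) (m : ℕ) :
    GZ → ℕ → ℕ → List (ℕ × ℕ) → σ → (GZ × ℕ × ℕ) × σ
  | acc, ρ, σ', [], s => ((acc, ρ, σ'), s)
  | acc, ρ, σ', (a, p) :: t, s =>
      let r := gzPow2AuxM mul (a % 2) ((a + m) % 2) (row a) p p s
      let r2 := mul (ρ, σ', rhoP (a % 2) p, sigP (a % 2) ((a + m) % 2) p) acc r.1 r.2
      gzProdAuxM mul row m r2.1 ((ρ + rhoP (a % 2) p) % 2) ((ρ + sigP (a % 2) ((a + m) % 2) p) % 2) t r2.2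

/-- `gzProd` with the product replaced by `mul` and the class row by `row`. [cite: FitznerVanDerHofstad2016NoBLE, §5.1.1 (5.4)–(5.5) pp. 1089–1090] -/
def gzProdM {σ : Type} (mul : (ℕ × ℕ × ℕ × ℕ) → GZ → GZ → σ → GZ × σ) (row : ℕ → GZ) (m L : ℕ) :
    List (ℕ × ℕ) → σ → (GZ × ℕ × ℕ) × σ
  | [], s => (((zeroPN L, zeroPN L), 0, 0), s)
  | (a, p) :: t, s =>
      let r := gzPow2AuxM mul (a % 2) ((a + m) % 2) (row a) p p s
      gzProdAuxM mul row m r.1 (rhoP (a % 2) p) (sigP (a % 2) ((a + m) % 2) p) t r.2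

/-- The parity-pair product of the table chain as an operation with parameter `(ρ₁, σ₁, ρ₂, σ₂)`.
[cite: FitznerVanDerHofstad2016NoBLE, §5.1.1 (5.4)–(5.5) pp. 1089–1090] -/
def opP (Mf L : ℕ) (k : ℕ × ℕ × ℕ × ℕ) (A B : GZ) : GZ := gzMulP Mf L k.1 k.2.1 k.2.2.1 k.2.2.2 A B

/-- With the computing product `mulId` the generic table power recursion is the original one. [folklore] -/
private theorem gzPow2AuxM_id {σ : Type} (Mf L ρ σ' : ℕ) (R : GZ) :
    ∀ (fuel p : ℕ) (s : σ), gzPow2AuxM (mulId (opP Mf L)) ρ σ' R fuel p s = (gzPow2Aux ρ σ' Mf L R fuel p, s) := by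
  intro fuel
  induction fuel with
  | zero => intro p s; rfl
  | succ fuel ih =>
      intro p s
      simp only [gzPow2AuxM, gzPow2Aux, ih, mulId, opP]
      cases Nat.ble p 1 <;> cases (p % 2 == 0) <;> rfl

/-- With the computing product `mulId` the generic table fold is the original one. [folklore] -/
private theorem gzProdAuxM_id {σ : Type} (Mf K m J : ℕ) (Q : ℕ → ℤ) :
    ∀ (t : List (ℕ × ℕ)) (acc : GZ) (ρ σ' : ℕ) (s : σ),
      gzProdAuxM (mulId (opP Mf (K + 1))) (fun a => gzRow2 Mf K (a % 2) ((a + m) % 2) m a J Q) m acc ρ σ' t s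
        = (gzProdAux Mf K m J Q acc ρ σ' t, s) := by
  intro t
  induction t with
  | nil => intro acc ρ σ' s; rfl
  | cons ap t ih =>
      intro acc ρ σ' s
      obtain ⟨a, p⟩ := ap
      simp only [gzProdAuxM, gzProdAux, gzPow2AuxM_id, gzClass, gzPow2, mulId, opP, ih]

/-- With the computing product `mulId` the generic table chain is the original chain `gzProd`. [folklore] -/
private theorem gzProdM_id {σ : Type} (Mf K m J : ℕ) (Q : ℕ → ℤ) (cls : List (ℕ × ℕ)) (s : σ) :
    gzProdM (mulId (opP Mf (K + 1))) (fun a => gzRow2 Mf K (a % 2) ((a + m) % 2) m a J Q) m (K + 1) cls s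
      = (gzProd Mf K m J Q cls, s) := by
  cases cls with
  | nil => rfl
  | cons ap t =>
      obtain ⟨a, p⟩ := ap
      simp only [gzProdM, gzProd, gzPow2AuxM_id, gzClass, gzPow2, gzProdAuxM_id]

/-- Replay of the table power recursion: the trace grows, and if the new entries are good the value is the true power. [folklore] -/
private theorem gzPow2AuxM_trace (Mf L ρ σ' : ℕ) (R : GZ) :
    ∀ (fuel p : ℕ) (s : MulState (ℕ × ℕ × ℕ × ℕ)), ∃ new : List (MulEntry (ℕ × ℕ × ℕ × ℕ)),
      (gzPow2AuxM (mulT (opP Mf L)) ρ σ' R fuel p s).2.2 = s.2 ++ new ∧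
      ((∀ e ∈ new, GoodEntry (opP Mf L) e) →
        (gzPow2AuxM (mulT (opP Mf L)) ρ σ' R fuel p s).1 = gzPow2Aux ρ σ' Mf L R fuel p) := by
  intro fuel
  induction fuel with
  | zero => intro p s; exact ⟨[], by simp [gzPow2AuxM], fun _ => rfl⟩
  | succ fuel ih =>
      intro p s
      simp only [gzPow2AuxM, gzPow2Aux]
      cases Nat.ble p 1 with
      | true => exact ⟨[], by simp, fun _ => rfl⟩
      | false =>
        cases (p % 2 == 0) with
        | true =>
          simp only [cond_true, cond_false]
          obtain ⟨new₁, h₁, g₁⟩ := ih (p / 2) s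
          obtain ⟨new₂, h₂, g₂⟩ := mulT_trace (opP Mf L)
            (rhoP ρ (p / 2), sigP ρ σ' (p / 2), rhoP ρ (p / 2), sigP ρ σ' (p / 2))
            (gzPow2AuxM (mulT (opP Mf L)) ρ σ' R fuel (p / 2) s).1
            (gzPow2AuxM (mulT (opP Mf L)) ρ σ' R fuel (p / 2) s).1
            (gzPow2AuxM (mulT (opP Mf L)) ρ σ' R fuel (p / 2) s).2
          refine ⟨new₁ ++ new₂, by rw [h₂, h₁, List.append_assoc], fun hall => ?_⟩
          have ga : ∀ e ∈ new₁, GoodEntry (opP Mf L) e := fun e he => hall e (List.mem_append_left _ he)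
          have gb : ∀ e ∈ new₂, GoodEntry (opP Mf L) e := fun e he => hall e (List.mem_append_right _ he)
          rw [g₂ gb, g₁ ga]
          rfl
        | false =>
          simp only [cond_false]
          obtain ⟨new₁, h₁, g₁⟩ := ih (p - 1) s
          obtain ⟨new₂, h₂, g₂⟩ := mulT_trace (opP Mf L) (ρ, σ', rhoP ρ (p - 1), sigP ρ σ' (p - 1)) R
            (gzPow2AuxM (mulT (opP Mf L)) ρ σ' R fuel (p - 1) s).1
            (gzPow2AuxM (mulT (opP Mf L)) ρ σ' R fuel (p - 1) s).2
          refine ⟨new₁ ++ new₂, by rw [h₂, h₁, List.append_assoc], fun hall => ?_⟩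
          have ga : ∀ e ∈ new₁, GoodEntry (opP Mf L) e := fun e he => hall e (List.mem_append_left _ he)
          have gb : ∀ e ∈ new₂, GoodEntry (opP Mf L) e := fun e he => hall e (List.mem_append_right _ he)
          rw [g₂ gb, g₁ ga]
          rfl

/-- Replay of the table fold: the trace grows, and if the new entries are good the value is the true fold. [folklore] -/
private theorem gzProdAuxM_trace (Mf L : ℕ) (row : ℕ → GZ) (m : ℕ) :
    ∀ (t : List (ℕ × ℕ)) (acc : GZ) (ρ σ' : ℕ) (s : MulState (ℕ × ℕ × ℕ × ℕ)),
      ∃ new : List (MulEntry (ℕ × ℕ × ℕ × ℕ)),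
      (gzProdAuxM (mulT (opP Mf L)) row m acc ρ σ' t s).2.2 = s.2 ++ new ∧
      ((∀ e ∈ new, GoodEntry (opP Mf L) e) →
        (gzProdAuxM (mulT (opP Mf L)) row m acc ρ σ' t s).1
          = (gzProdAuxM (mulId (opP Mf L)) row m acc ρ σ' t ()).1) := by
  intro t
  induction t with
  | nil => intro acc ρ σ' s; exact ⟨[], by simp [gzProdAuxM], fun _ => rfl⟩
  | cons ap t ih =>
      intro acc ρ σ' s
      obtain ⟨a, p⟩ := ap
      simp only [gzProdAuxM]
      obtain ⟨new₁, h₁, g₁⟩ := gzPow2AuxM_trace Mf L (a % 2) ((a + m) % 2) (row a) p p s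
      obtain ⟨new₂, h₂, g₂⟩ := mulT_trace (opP Mf L) (ρ, σ', rhoP (a % 2) p, sigP (a % 2) ((a + m) % 2) p) acc
        (gzPow2AuxM (mulT (opP Mf L)) (a % 2) ((a + m) % 2) (row a) p p s).1
        (gzPow2AuxM (mulT (opP Mf L)) (a % 2) ((a + m) % 2) (row a) p p s).2
      obtain ⟨new₃, h₃, g₃⟩ := ih
        (mulT (opP Mf L) (ρ, σ', rhoP (a % 2) p, sigP (a % 2) ((a + m) % 2) p) acc
          (gzPow2AuxM (mulT (opP Mf L)) (a % 2) ((a + m) % 2) (row a) p p s).1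
          (gzPow2AuxM (mulT (opP Mf L)) (a % 2) ((a + m) % 2) (row a) p p s).2).1
        ((ρ + rhoP (a % 2) p) % 2) ((ρ + sigP (a % 2) ((a + m) % 2) p) % 2)
        (mulT (opP Mf L) (ρ, σ', rhoP (a % 2) p, sigP (a % 2) ((a + m) % 2) p) acc
          (gzPow2AuxM (mulT (opP Mf L)) (a % 2) ((a + m) % 2) (row a) p p s).1
          (gzPow2AuxM (mulT (opP Mf L)) (a % 2) ((a + m) % 2) (row a) p p s).2).2
      refine ⟨new₁ ++ new₂ ++ new₃, by rw [h₃, h₂, h₁]; simp only [List.append_assoc], fun hall => ?_⟩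
      have ga : ∀ e ∈ new₁, GoodEntry (opP Mf L) e := fun e he => hall e (by simp [he])
      have gb : ∀ e ∈ new₂, GoodEntry (opP Mf L) e := fun e he => hall e (by simp [he])
      have gc : ∀ e ∈ new₃, GoodEntry (opP Mf L) e := fun e he => hall e (by simp [he])
      rw [g₃ gc, g₂ gb, g₁ ga]
      simp only [mulId, gzPow2AuxM_id]

/-- Replay of the table chain: the trace grows, and if the new entries are good the value is the true product table. [folklore] -/
private theorem gzProdM_trace (Mf L : ℕ) (row : ℕ → GZ) (m : ℕ) (cls : List (ℕ × ℕ))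
    (s : MulState (ℕ × ℕ × ℕ × ℕ)) : ∃ new : List (MulEntry (ℕ × ℕ × ℕ × ℕ)),
      (gzProdM (mulT (opP Mf L)) row m L cls s).2.2 = s.2 ++ new ∧
      ((∀ e ∈ new, GoodEntry (opP Mf L) e) →
        (gzProdM (mulT (opP Mf L)) row m L cls s).1 = (gzProdM (mulId (opP Mf L)) row m L cls ()).1) := by
  cases cls with
  | nil => exact ⟨[], by simp [gzProdM], fun _ => rfl⟩
  | cons ap t =>
      obtain ⟨a, p⟩ := ap
      simp only [gzProdM]
      obtain ⟨new₁, h₁, g₁⟩ := gzPow2AuxM_trace Mf L (a % 2) ((a + m) % 2) (row a) p p s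
      obtain ⟨new₂, h₂, g₂⟩ := gzProdAuxM_trace Mf L row m t
        (gzPow2AuxM (mulT (opP Mf L)) (a % 2) ((a + m) % 2) (row a) p p s).1
        (rhoP (a % 2) p) (sigP (a % 2) ((a + m) % 2) p)
        (gzPow2AuxM (mulT (opP Mf L)) (a % 2) ((a + m) % 2) (row a) p p s).2
      refine ⟨new₁ ++ new₂, by rw [h₂, h₁, List.append_assoc], fun hall => ?_⟩
      have ga : ∀ e ∈ new₁, GoodEntry (opP Mf L) e := fun e he => hall e (List.mem_append_left _ he)
      have gb : ∀ e ∈ new₂, GoodEntry (opP Mf L) e := fun e he => hall e (List.mem_append_right _ he)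
      rw [g₂ gb, g₁ ga]
      simp only [gzPow2AuxM_id]

/-! ### The class polynomial from a table of main coefficient lists -/

/-- `wTermGZ2` with `2^S Mid_b` READ from the table `mids` (entry `b`; the zero list if absent).
[cite: FitznerVanDerHofstad2016NoBLE, §5.1.1 (5.4)–(5.5) pp. 1089–1090] -/
def wTermGZ2S (mids : List (List ℕ × List ℕ)) (ℓ m a : ℕ) (Q : ℕ → ℤ) (j s : ℕ) : GZ :=
  let b := cosOrd m a j s
  let cabs := cosW a Q j s
  let neg : Bool := xor (decide (Q j < 0)) (decide (2 ≤ j % 4))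
  let base := smulPN cabs (mids.getD b (zeroPN ℓ))
  let t := bif neg then negPN base else base
  let z := zeroPN ℓ
  if j % 2 = 0 then (t, z) else (z, t)

/-- `gzP2` with the main coefficient lists read from the table `mids`. [cite: FitznerVanDerHofstad2016NoBLE, §5.1.1 (5.4)–(5.5) pp. 1089–1090] -/
def gzP2S (mids : List (List ℕ × List ℕ)) (ℓ m a J : ℕ) (Q : ℕ → ℤ) : GZ :=
  let z := zeroPN ℓ
  let s := gzSum (fun i => wTermGZ2S mids ℓ m a Q (i / (a + 1)) (i % (a + 1))) ((J + 1) * (a + 1)) (z, z)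
  (forcePN (normPN s.1), forcePN (normPN s.2))

/-- `gzSum` depends only on the values of the summands below the bound. [folklore] -/
private theorem gzSum_congr {f g : ℕ → GZ} : ∀ (n : ℕ) (acc : GZ), (∀ i < n, f i = g i) → gzSum f n acc = gzSum g n acc := by
  intro n
  induction n with
  | zero => intro acc _; rfl
  | succ n ih =>
      intro acc h
      simp only [gzSum]
      rw [h n (Nat.lt_succ_self n), ih _ (fun i hi => h i (Nat.lt_succ_of_lt hi))]

/-- The Bessel order of the `(j,s)` term is at most `jm + a` (for `s ≤ a`). [folklore] -/
private theorem cosOrd_le_lin (m a j s : ℕ) (hs : s ≤ a) : cosOrd m a j s ≤ j * m + a := by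
  unfold cosOrd
  split_ifs <;> omega

/-- A class-polynomial term read from a correct table of main coefficient lists is the computed term. [folklore] -/
private theorem wTermGZ2S_eq (mids : List (List ℕ × List ℕ)) (Jb S ℓ m a : ℕ) (Q : ℕ → ℤ) (j s : ℕ)
    (h : mids.getD (cosOrd m a j s) (zeroPN ℓ) = pnOfZ (midListZ (cosOrd m a j s) Jb S ℓ)) :
    wTermGZ2S mids ℓ m a Q j s = wTermGZ2 Jb S ℓ m a Q j s := by
  unfold wTermGZ2S wTermGZ2
  simp only [h]

/-- The table-read class polynomial IS the class polynomial once the table holds `2^S Mid_b` for every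
order `b ≤ Jm + a`. [cite: FitznerVanDerHofstad2016NoBLE, §5.1.1 (5.4)–(5.5) pp. 1089–1090] -/
theorem gzP2S_eq (mids : List (List ℕ × List ℕ)) (Jb S ℓ m a J : ℕ) (Q : ℕ → ℤ)
    (hm : ∀ b, b ≤ J * m + a → mids.getD b (zeroPN ℓ) = pnOfZ (midListZ b Jb S ℓ)) :
    gzP2S mids ℓ m a J Q = gzP2 Jb S ℓ m a J Q := by
  unfold gzP2S gzP2
  have hc : ∀ i < (J + 1) * (a + 1),
      wTermGZ2S mids ℓ m a Q (i / (a + 1)) (i % (a + 1)) = wTermGZ2 Jb S ℓ m a Q (i / (a + 1)) (i % (a + 1)) := by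
    intro i hi
    apply wTermGZ2S_eq
    apply hm
    have hj : i / (a + 1) ≤ J := by
      have : i / (a + 1) < J + 1 := by
        rw [Nat.div_lt_iff_lt_mul (Nat.succ_pos a)]
        exact hi
      omega
    have hs : i % (a + 1) ≤ a := Nat.lt_succ_iff.mp (Nat.mod_lt i (Nat.succ_pos a))
    calc cosOrd m a (i / (a + 1)) (i % (a + 1)) ≤ i / (a + 1) * m + a := cosOrd_le_lin m a _ _ hs
      _ ≤ J * m + a := by
          have := Nat.mul_le_mul_right m hj
          omega
  simp only [gzSum_congr _ _ hc]

/-! ### Generators (interpreter side)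

The tables of a staged certificate are produced by running the kernel functions in the INTERPRETER (`eval%` in an
instance file).  `tHalfCoeff` (the Chebyshev coefficient recursion behind `midListZ`) is a double recursion that
is cheap under the kernel's sharing of closed subterms but exponential when interpreted, so the generator computes
the same coefficient rows iteratively (`tHalfRowsRev`); nothing is claimed about the generators — their output is
what the order checks and step checks verify. -/

/-- Row `n + 2` of the coefficient recursion of `T_n(1-2y)` from rows `n`, `n + 1` (width `W`):
`t_{n+2,0} = 2t_{n+1,0} - t_{n,0}`, `t_{n+2,k+1} = 2t_{n+1,k+1} - 4t_{n+1,k} - t_{n,k+1}`. [folklore] -/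
def tHalfNextRow (W : ℕ) (r0 r1 : List ℚ) : List ℚ :=
  (List.range W).map fun k =>
    if k = 0 then 2 * r1.getD 0 0 - r0.getD 0 0 else 2 * r1.getD k 0 - 4 * r1.getD (k - 1) 0 - r0.getD k 0

/-- The coefficient rows `[t_{n,k}]_{k<W}` of `T_n(1-2y)` for `n = N, N-1, …, 0` (head = row `N`), iteratively.
[folklore] -/
def tHalfRowsRev (W : ℕ) : ℕ → List (List ℚ)
  | 0 => [(List.range W).map fun k => if k = 0 then 1 else 0]
  | 1 => [(List.range W).map fun k => if k = 0 then 1 else if k = 1 then -2 else 0,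
      (List.range W).map fun k => if k = 0 then 1 else 0]
  | n + 2 =>
      match tHalfRowsRev W (n + 1) with
      | r1 :: r0 :: rest => tHalfNextRow W r0 r1 :: r1 :: r0 :: rest
      | l => l

/-- `mcoef a J i` computed from the coefficient row of `T_a(1-2y)` and the table `[β_j]_j`. [folklore] -/
def mcoefRow (trow betas : List ℚ) (J i : ℕ) : ℚ :=
  (∑ k ∈ Finset.range (i + 1), trow.getD k 0 * (if i - k ≤ J then betas.getD (i - k) 0 else 0)) *
    ((2 * i - 1).doubleFactorial : ℚ) / 4 ^ i

/-- `midListZ a J S ℓ` computed from the coefficient row of `T_a(1-2y)` and the table `[β_j]_j`. [folklore] -/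
def midListZRow (trow betas : List ℚ) (a J S ℓ : ℕ) : List ℤ :=
  ((List.range (blen a J)).map fun i => scaleZ S (mcoefRow trow betas J i)) ++ List.replicate (ℓ - blen a J) 0

namespace PrCert

variable (c : PrCert)

/-- GENERATOR of the table `[2^S Mid_b | b ≤ Jm + max a]` (as `(pos, neg)` lists of length `lw2`).
[cite: FitznerVanDerHofstad2016NoBLE, §5.1.1 (5.4)–(5.5) pp. 1089–1090] -/
def midsGen : List (List ℕ × List ℕ) :=
  let W := c.lw2
  let rows := (tHalfRowsRev W c.maxOrd).reverse
  let betas := (List.range W).map Literature.Probability.LatticeModels.invSqrtCoeffQ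
  (List.range (c.maxOrd + 1)).map fun b => pnOfZ (midListZRow (rows.getD b []) betas b c.Jb c.S c.lw2)

/-- GENERATOR of the successive products of the `w`-polynomial chain `gzWProd` (class polynomials from
`midsGen`). [cite: FitznerVanDerHofstad2016NoBLE, §5.1.1 (5.4)–(5.5) pp. 1089–1090] -/
def resWGen : List GZ :=
  let mids := c.midsGen
  (gzWProdM (mulRec (fun L A B => gzMulW L A B)) (fun a => gzP2S mids c.lw2 c.m a c.J c.Q) c.lw2 c.cls []).2

/-- GENERATOR of the successive products of the table chain `gzProd`. [cite: FitznerVanDerHofstad2016NoBLE, §5.1.1 (5.4)–(5.5) pp. 1089–1090] -/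
def resPGen : List GZ :=
  (gzProdM (mulRec (opP (prodRange 0 c.Mh) (c.K + 1)))
    (fun a => gzRow2 (prodRange 0 c.Mh) c.K (a % 2) ((a + c.m) % 2) c.m a c.J c.Q) c.m (c.K + 1) c.cls []).2

end PrCert

/-! ### Staged certificates -/

/-- A product-row twisted seed certificate EXTENDED by the three claimed tables: `mids` (main coefficient
lists per order), `resW` (products of the `w`-polynomial chain), `resP` (products of the table chain).
[cite: FitznerVanDerHofstad2016NoBLE, §5.1.1 (5.4)–(5.5) pp. 1089–1090] -/
structure PrCertS extends PrCert where
  mids : List (List ℕ × List ℕ)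
  resW : List GZ
  resP : List GZ

namespace PrCertS

variable (c : PrCertS) (D : ℕ)

/-- The hat base `M̂! ` of the table layer. [cite: FitznerVanDerHofstad2016NoBLE, §5.1.1 (5.4)–(5.5) pp. 1089–1090] -/
def Mf : ℕ := prodRange 0 c.Mh

/-- The class row of the table layer. [cite: FitznerVanDerHofstad2016NoBLE, §5.1.1 (5.4)–(5.5) pp. 1089–1090] -/
def rowP (a : ℕ) : GZ := gzRow2 c.Mf c.K (a % 2) ((a + c.m) % 2) c.m a c.J c.Q

/-- The class polynomial of the `[T,∞)` layer, read from `mids`. [cite: FitznerVanDerHofstad2016NoBLE, §5.1.1 (5.4)–(5.5) pp. 1089–1090] -/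
def polyW (a : ℕ) : GZ := gzP2S c.mids c.lw2 c.m a c.J c.Q

/-- The replayed `w`-polynomial chain: (value, (unconsumed results, trace)). [cite: FitznerVanDerHofstad2016NoBLE, §5.1.1 (5.4)–(5.5) pp. 1089–1090] -/
def runW : (GZ × ℕ) × MulState ℕ :=
  gzWProdM (mulT (fun L A B => gzMulW L A B)) c.polyW c.lw2 c.cls (c.resW, [])

/-- The replayed table chain: (value, (unconsumed results, trace)). [cite: FitznerVanDerHofstad2016NoBLE, §5.1.1 (5.4)–(5.5) pp. 1089–1090] -/
def runP : (GZ × ℕ × ℕ) × MulState (ℕ × ℕ × ℕ × ℕ) :=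
  gzProdM (mulT (opP c.Mf (c.K + 1))) c.rowP c.m (c.K + 1) c.cls (c.resP, [])

/-- The trace of the `w`-polynomial chain. [cite: FitznerVanDerHofstad2016NoBLE, §5.1.1 (5.4)–(5.5) pp. 1089–1090] -/
def traceW : List (MulEntry ℕ) := c.runW.2.2

/-- The trace of the table chain. [cite: FitznerVanDerHofstad2016NoBLE, §5.1.1 (5.4)–(5.5) pp. 1089–1090] -/
def traceP : List (MulEntry (ℕ × ℕ × ℕ × ℕ)) := c.runP.2.2

/-- The replayed `powRe2`. [cite: FitznerVanDerHofstad2016NoBLE, §5.1.1 (5.4)–(5.5) pp. 1089–1090] -/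
def powRe2S : List ℕ × List ℕ := c.runW.1.1.1

/-- The replayed `tableP`. [cite: FitznerVanDerHofstad2016NoBLE, §5.1.1 (5.4)–(5.5) pp. 1089–1090] -/
def tablePS : GZ × ℕ × ℕ := c.runP.1

/-- **Order check** for the Bessel order `b`: nonnegative valid bracket constant, dyadic main coefficients,
and the table entry `mids[b]` IS `2^S Mid_b`. (Kernel cost: one `midList`.) [cite: FitznerVanDerHofstad2016NoBLE, §5.1.1 (5.4)–(5.5) pp. 1089–1090] -/
def ordOK (b : ℕ) : Bool :=
  decide (0 ≤ c.eps b) && decide (epsBoundQ b c.Jb c.s0 c.t c.sHi c.nexp ≤ c.eps b) &&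
  (midList b c.Jb).all (dyadicOK c.S) &&
  (c.mids.getD b (zeroPN c.lw2) == pnOfZ (midListZ b c.Jb c.S c.lw2))

/-- The order checks for `lo ≤ b < lo + n` (a chunk; its own `decide`). [cite: FitznerVanDerHofstad2016NoBLE, §5.1.1 (5.4)–(5.5) pp. 1089–1090] -/
def ordOKR (lo n : ℕ) : Bool := (List.range' lo n).all c.ordOK

/-- **Step check** of the `w`-polynomial chain: the `k`-th claimed product is the product of its recorded
operands. (Kernel cost: one `gzMulW`.) [cite: FitznerVanDerHofstad2016NoBLE, §5.1.1 (5.4)–(5.5) pp. 1089–1090] -/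
def stepWOK (k : ℕ) : Bool := stepOK (fun L A B => gzMulW L A B) c.traceW k

/-- The step checks `lo ≤ k < lo + n` of the `w`-polynomial chain. [cite: FitznerVanDerHofstad2016NoBLE, §5.1.1 (5.4)–(5.5) pp. 1089–1090] -/
def stepWOKR (lo n : ℕ) : Bool := stepOKR (fun L A B => gzMulW L A B) c.traceW lo n

/-- **Step check** of the table chain: the `k`-th claimed product is the product of its recorded operands.
(Kernel cost: one `gzMulP`.) [cite: FitznerVanDerHofstad2016NoBLE, §5.1.1 (5.4)–(5.5) pp. 1089–1090] -/
def stepPOK (k : ℕ) : Bool := stepOK (opP c.Mf (c.K + 1)) c.traceP k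

/-- The step checks `lo ≤ k < lo + n` of the table chain. [cite: FitznerVanDerHofstad2016NoBLE, §5.1.1 (5.4)–(5.5) pp. 1089–1090] -/
def stepPOKR (lo n : ℕ) : Bool := stepOKR (opP c.Mf (c.K + 1)) c.traceP lo n

/-- **Tail layer check, main part, staged**: `imLo n ≤ IM_n ≤ imHi n` for the REPLAYED product polynomial.
(Kernel cost: the class polynomials from `mids`, the lookups, four folds.) [cite: FitznerVanDerHofstad2016NoBLE, §5.1.1 (5.4)–(5.5) pp. 1089–1090] -/
def tailCheckIMS : Bool :=
  let pr := c.powRe2S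
  (List.range 4).all fun i =>
    decide (c.imLo (i + 1) ≤ c.IM2 D pr (i + 1)) && decide (c.IM2 D pr (i + 1) ≤ c.imHi (i + 1))

/-- **Poisson layer check, staged**: real parity `0` and the `P_n`, `U_n` brackets for the REPLAYED table.
(Kernel cost: the class rows, the lookups, the Horner sums.) [cite: FitznerVanDerHofstad2016NoBLE, §5.1.1 (5.4)–(5.5) pp. 1089–1090] -/
def poissonCheckPS : Bool :=
  let tp := c.tablePS
  let re := tp.1.1
  decide (tp.2.1 = 0) &&
  (List.range 4).all fun i =>
    decide (c.pLo (i + 1) ≤ c.PqP D re (i + 1)) && decide (c.PqP D re (i + 1) ≤ c.pHi (i + 1)) &&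
    decide (c.uLo (i + 1) ≤ c.UqP D re (i + 1)) && decide (c.UqP D re (i + 1) ≤ c.uHi (i + 1))

/-- `TwCert.paramsOKT` WITHOUT its per-order conjunct (supplied by the order checks). [cite: FitznerVanDerHofstad2016NoBLE, §5.1.1 (5.4)–(5.5) pp. 1089–1090] -/
def paramsOKTS : Bool :=
  decide (0 < c.s0) && decide (c.s0 < 1) && decide (((c.Jb : ℚ) + 3 / 2) / (2 * c.s0 ^ 2) ≤ (c.t : ℚ) ^ 2) &&
  decide (0 < c.t) && decide (0 < c.m) && decide (9 ≤ D) && decide (0 < c.qden) && decide (0 < c.nexp) &&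
  decide (0 < c.sLo) && decide (c.sLo ^ 2 ≤ 2 * piLo) && decide (0 < c.sHi) && decide (2 * piHi ≤ c.sHi ^ 2) &&
  decide (0 ≤ expNegOneLo) &&
  (List.range (c.J + 1)).all (fun j => decide ((c.Q j).natAbs ≤ c.qden)) &&
  decide (0 ≤ c.eps 0) && decide (epsBoundQ 0 c.Jb c.s0 c.t c.sHi c.nexp ≤ c.eps 0) &&
  (upList 0 c.Jb (c.eps 0)).all (fun x => dyadicOK c.S x && decide (0 ≤ x)) &&
  dyadicOK c.S c.alpha && dyadicOK c.S c.rho && decide (0 ≤ c.rho) &&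
  decide ((c.toPrCert.toTwCert.wabsSum : ℚ) ≤ c.alpha * c.qden) &&
  decide (c.toPrCert.toTwCert.wepsSum ≤ c.rho * c.qden) &&
  (List.range 4).all (fun i =>
    decide (1 ≤ c.M (i + 1)) && decide (c.M (i + 1) ≤ 2 * c.K + 2) &&
    decide (c.toPrCert.toTwCert.cnt (i + 1) ≤ c.K + 1) &&
    decide (c.toPrCert.toTwCert.lamT D + 1 < c.M (i + 1)))

/-- `PrCert.extraOKP` WITHOUT its per-order conjunct (supplied by the order checks). [cite: FitznerVanDerHofstad2016NoBLE, §5.1.1 (5.4)–(5.5) pp. 1089–1090] -/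
def extraOKPS : Bool :=
  decide (c.cls ≠ []) && c.cls.all (fun ap => decide (1 ≤ ap.2)) && decide (c.toPrCert.psum = D) &&
  decide (c.toPrCert.asum % 2 = 0) &&
  c.cls.all (fun ap => decide (c.toPrCert.wepsSum2 ap.1 ≤ c.rho * c.qden * (2 : ℚ) ^ ap.1))

/-- **All parameter checks, staged** (the per-order conjuncts live in `ordOKR`). (Kernel cost: seconds.)
[cite: FitznerVanDerHofstad2016NoBLE, §5.1.1 (5.4)–(5.5) pp. 1089–1090] -/
def paramsOKPS : Bool := c.paramsOKTS D && c.extraOKPS D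

/-! ### Gluing lemmas for instance files -/

/-- `ordOKR` unfolded: every order of the range passes `ordOK`. [folklore] -/
private theorem ordOKR_iff (lo n : ℕ) : c.ordOKR lo n = true ↔ ∀ b, lo ≤ b → b < lo + n → c.ordOK b = true := by
  unfold ordOKR
  rw [List.all_eq_true]
  constructor
  · intro h b h1 h2
    exact h b (List.mem_range'_1.2 ⟨h1, h2⟩)
  · intro h b hb
    obtain ⟨h1, h2⟩ := List.mem_range'_1.1 hb
    exact h b h1 h2

/-- Gluing of two adjacent chunks of order checks. [cite: FitznerVanDerHofstad2016NoBLE, §5.1.1 (5.4)–(5.5) pp. 1089–1090] -/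
theorem ordOKR_append (lo n₁ lo₂ n₂ n : ℕ) (hlo : lo₂ = lo + n₁) (hn : n = n₁ + n₂)
    (h₁ : c.ordOKR lo n₁ = true) (h₂ : c.ordOKR lo₂ n₂ = true) : c.ordOKR lo n = true := by
  subst hlo hn
  rw [ordOKR_iff] at h₁ h₂ ⊢
  intro b hb1 hb2
  by_cases hb : b < lo + n₁
  · exact h₁ b hb1 hb
  · exact h₂ b (by omega) (by omega)

/-- Gluing of two adjacent ranges of step checks (`w`-polynomial chain). [cite: FitznerVanDerHofstad2016NoBLE, §5.1.1 (5.4)–(5.5) pp. 1089–1090] -/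
theorem stepWOKR_append (lo n₁ lo₂ n₂ n : ℕ) (hlo : lo₂ = lo + n₁) (hn : n = n₁ + n₂)
    (h₁ : c.stepWOKR lo n₁ = true) (h₂ : c.stepWOKR lo₂ n₂ = true) : c.stepWOKR lo n = true :=
  stepOKR_append _ _ lo n₁ lo₂ n₂ n hlo hn h₁ h₂

/-- Gluing of two adjacent ranges of step checks (table chain). [cite: FitznerVanDerHofstad2016NoBLE, §5.1.1 (5.4)–(5.5) pp. 1089–1090] -/
theorem stepPOKR_append (lo n₁ lo₂ n₂ n : ℕ) (hlo : lo₂ = lo + n₁) (hn : n = n₁ + n₂)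
    (h₁ : c.stepPOKR lo n₁ = true) (h₂ : c.stepPOKR lo₂ n₂ = true) : c.stepPOKR lo n = true :=
  stepOKR_append _ _ lo n₁ lo₂ n₂ n hlo hn h₁ h₂

/-- One step check as a range of length one. [cite: FitznerVanDerHofstad2016NoBLE, §5.1.1 (5.4)–(5.5) pp. 1089–1090] -/
theorem stepWOKR_one (k : ℕ) (h : c.stepWOK k = true) : c.stepWOKR k 1 = true := by
  unfold stepWOKR stepOKR
  unfold stepWOK at h
  simpa [List.range'] using h

/-- One step check as a range of length one. [cite: FitznerVanDerHofstad2016NoBLE, §5.1.1 (5.4)–(5.5) pp. 1089–1090] -/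
theorem stepPOKR_one (k : ℕ) (h : c.stepPOK k = true) : c.stepPOKR k 1 = true := by
  unfold stepPOKR stepOKR
  unfold stepPOK at h
  simpa [List.range'] using h

/-- The whole-trace form of the step checks from a range `0 … n` and the trace length. [cite: FitznerVanDerHofstad2016NoBLE, §5.1.1 (5.4)–(5.5) pp. 1089–1090] -/
theorem stepWOKR_len (n : ℕ) (hn : c.traceW.length = n) (h : c.stepWOKR 0 n = true) :
    c.stepWOKR 0 c.traceW.length = true := by
  rw [hn]; exact h

/-- The whole-trace form of the step checks from a range `0 … n` and the trace length. [cite: FitznerVanDerHofstad2016NoBLE, §5.1.1 (5.4)–(5.5) pp. 1089–1090] -/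
theorem stepPOKR_len (n : ℕ) (hn : c.traceP.length = n) (h : c.stepPOKR 0 n = true) :
    c.stepPOKR 0 c.traceP.length = true := by
  rw [hn]; exact h

/-! ### Soundness of the staging -/

/-- `maxNAux l m` bounds `m` and every entry of `l`. [folklore] -/
private theorem maxNAux_bounds (l : List ℕ) : ∀ m, m ≤ maxNAux l m ∧ ∀ x ∈ l, x ≤ maxNAux l m := by
  induction l with
  | nil => intro m; simp [maxNAux]
  | cons y ys ih =>
      intro m
      simp only [maxNAux, List.mem_cons]
      by_cases hmy : m ≤ y
      · rw [if_pos hmy]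
        obtain ⟨h1, h2⟩ := ih y
        exact ⟨le_trans hmy h1, fun x hx => hx.elim (fun e => by rw [e]; exact h1) (h2 x)⟩
      · rw [if_neg hmy]
        obtain ⟨h1, h2⟩ := ih m
        exact ⟨h1, fun x hx => hx.elim (fun e => by rw [e]; exact le_trans (le_of_lt (not_le.mp hmy)) h1) (h2 x)⟩

/-- Every class exponent `a` is at most `amax`. [folklore] -/
private theorem le_amax_of_mem (a p : ℕ) (h : (a, p) ∈ c.cls) : a ≤ c.amax := by
  unfold PrCert.amax maxN
  exact (maxNAux_bounds _ 0).2 a (List.mem_map.2 ⟨(a, p), h, rfl⟩)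

/-- All orders `b ≤ maxOrd` pass `ordOK` when the whole range does. [folklore] -/
private theorem ordOK_of_ordOKR (h : c.ordOKR 0 (c.maxOrd + 1) = true) : ∀ b, b ≤ c.maxOrd → c.ordOK b = true :=
  fun b hb => (c.ordOKR_iff 0 (c.maxOrd + 1)).1 h b (Nat.zero_le b) (by omega)

/-- The claimed table `mids` is the table of scaled main coefficient lists when the whole order range passes. [folklore] -/
private theorem mids_of_ordOKR (h : c.ordOKR 0 (c.maxOrd + 1) = true) :
    ∀ b, b ≤ c.maxOrd → c.mids.getD b (zeroPN c.lw2) = pnOfZ (midListZ b c.Jb c.S c.lw2) := by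
  intro b hb
  have hb' := c.ordOK_of_ordOKR h b hb
  unfold ordOK at hb'
  simp only [Bool.and_eq_true, beq_iff_eq] at hb'
  exact hb'.2

/-- The class polynomial assembled from the claimed table is the computed class polynomial `gzP2`. [folklore] -/
private theorem polyW_eq (h : c.ordOKR 0 (c.maxOrd + 1) = true) (a : ℕ) (ha : a ≤ c.amax) :
    c.polyW a = gzP2 c.Jb c.S c.lw2 c.m a c.J c.Q := by
  unfold polyW
  apply gzP2S_eq
  intro b hb
  apply c.mids_of_ordOKR h
  unfold PrCert.maxOrd
  omega

/-- **The replayed product polynomial is `powRe2`** once every order check and every step check holds.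
[cite: FitznerVanDerHofstad2016NoBLE, §5.1.1 (5.4)–(5.5) pp. 1089–1090] -/
theorem powRe2S_eq (hord : c.ordOKR 0 (c.maxOrd + 1) = true) (hst : c.stepWOKR 0 c.traceW.length = true) :
    c.powRe2S = c.toPrCert.powRe2 := by
  have hP : ∀ ap ∈ c.cls, c.polyW ap.1 = (fun a => gzP2 c.Jb c.S c.lw2 c.m a c.J c.Q) ap.1 :=
    fun ap hap => c.polyW_eq hord ap.1 (c.le_amax_of_mem ap.1 ap.2 hap)
  have hrun : c.runW = gzWProdM (mulT (fun L A B => gzMulW L A B))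
      (fun a => gzP2 c.Jb c.S c.lw2 c.m a c.J c.Q) c.lw2 c.cls (c.resW, []) := by
    unfold runW
    exact gzWProdM_congr _ _ _ _ _ _ hP
  have hgood := good_of_stepOKR _ _ hst
  unfold traceW at hgood
  rw [hrun] at hgood
  obtain ⟨new, hnew, g⟩ := gzWProdM_trace (fun a => gzP2 c.Jb c.S c.lw2 c.m a c.J c.Q) c.lw2 c.cls (c.resW, [])
  have hall : ∀ e ∈ new, GoodEntry (fun L A B => gzMulW L A B) e := by
    intro e he
    apply hgood e
    rw [hnew]
    exact List.mem_append_right _ he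
  unfold powRe2S PrCert.powRe2
  rw [hrun, g hall, gzWProdM_id]

/-- **The replayed product table is `tableP`** once every step check holds. [cite: FitznerVanDerHofstad2016NoBLE, §5.1.1 (5.4)–(5.5) pp. 1089–1090] -/
theorem tablePS_eq (hst : c.stepPOKR 0 c.traceP.length = true) : c.tablePS = c.toPrCert.tableP := by
  have hgood := good_of_stepOKR _ _ hst
  unfold traceP runP at hgood
  obtain ⟨new, hnew, g⟩ := gzProdM_trace c.Mf (c.K + 1) c.rowP c.m c.cls (c.resP, [])
  have hall : ∀ e ∈ new, GoodEntry (opP c.Mf (c.K + 1)) e := by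
    intro e he
    apply hgood e
    rw [hnew]
    exact List.mem_append_right _ he
  unfold tablePS runP PrCert.tableP
  rw [g hall]
  unfold rowP Mf
  rw [gzProdM_id]

/-- **`tailCheckIM` from the staged check** and the local obligations. [cite: FitznerVanDerHofstad2016NoBLE, §5.1.1 (5.4)–(5.5) pp. 1089–1090] -/
theorem tailCheckIM_of_staged (hord : c.ordOKR 0 (c.maxOrd + 1) = true)
    (hst : c.stepWOKR 0 c.traceW.length = true) (h : c.tailCheckIMS D = true) :
    c.toPrCert.tailCheckIM D = true := by
  have e := c.powRe2S_eq hord hst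
  simp only [tailCheckIMS] at h
  simp only [PrCert.tailCheckIM]
  rw [← e]
  exact h

/-- **`poissonCheckP` from the staged check** and the local obligations. [cite: FitznerVanDerHofstad2016NoBLE, §5.1.1 (5.4)–(5.5) pp. 1089–1090] -/
theorem poissonCheckP_of_staged (hst : c.stepPOKR 0 c.traceP.length = true) (h : c.poissonCheckPS D = true) :
    c.toPrCert.poissonCheckP D = true := by
  have e := c.tablePS_eq hst
  simp only [poissonCheckPS] at h
  simp only [PrCert.poissonCheckP]
  rw [← e]
  exact h

/-- **`paramsOKP` from the staged check** and the order checks. [cite: FitznerVanDerHofstad2016NoBLE, §5.1.1 (5.4)–(5.5) pp. 1089–1090] -/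
theorem paramsOKP_of_staged (hord : c.ordOKR 0 (c.maxOrd + 1) = true) (h : c.paramsOKPS D = true) :
    c.toPrCert.paramsOKP D = true := by
  have hb := c.ordOK_of_ordOKR hord
  have hO : c.toPrCert.toTwCert.orders.all (fun a =>
      decide (0 ≤ c.eps a) && decide (epsBoundQ a c.Jb c.s0 c.t c.sHi c.nexp ≤ c.eps a) &&
      (midList a c.Jb).all (dyadicOK c.S)) = true := by
    rw [List.all_eq_true]
    intro a ha
    unfold TwCert.orders at ha
    obtain ⟨j, hj, hja⟩ := List.mem_map.1 ha
    have hjJ : j ≤ c.J := Nat.lt_succ_iff.mp (List.mem_range.1 hj)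
    have hja' : a = j * c.m := hja.symm
    have hle : a ≤ c.maxOrd := by
      rw [hja']
      unfold PrCert.maxOrd
      have := Nat.mul_le_mul_right c.m hjJ
      omega
    have h1 := hb a hle
    unfold ordOK at h1
    simp only [Bool.and_eq_true] at h1 ⊢
    exact h1.1
  have hR : (List.range (c.maxOrd + 1)).all (fun b =>
      decide (0 ≤ c.eps b) && decide (epsBoundQ b c.Jb c.s0 c.t c.sHi c.nexp ≤ c.eps b) &&
      (midList b c.Jb).all (dyadicOK c.S)) = true := by
    rw [List.all_eq_true]
    intro b hb'
    have h1 := hb b (Nat.lt_succ_iff.mp (List.mem_range.1 hb'))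
    unfold ordOK at h1
    simp only [Bool.and_eq_true] at h1 ⊢
    exact h1.1
  unfold paramsOKPS paramsOKTS extraOKPS at h
  unfold PrCert.paramsOKP TwCert.paramsOKT PrCert.extraOKP
  simp only [Bool.and_eq_true] at h hO hR ⊢
  tauto

end PrCertS

end Literature.Probability.FitznerVanDerHofstad2017.SeedCert
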